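import Summits.AtomisticToContinuum.HydrodynamicLimit.Theorems.EnskogAdjointDualityAdjointEnskogTestFamilyRMaxwellianParam
import Mathlib.Analysis.Calculus.ParametricIntegral
import Mathlib.Analysis.SpecialFunctions.JapaneseBracket
import HarnessLib

/-!
# EnskogAdjointDuality / AdjointEnskogTestFamilyR — Maxwellian characteristic derivative,
# part 4: differentiating polynomial moments of the local Maxwellian along a parameter curve

Support lemmas for the stub `stub_maxwellianCharDeriv` (B2) of the line `birth` of the crux
`Summit.AtomisticToContinuum.HydrodynamicLimit.Theses.EnskogAdjointDuality.AdjointEnskogTestFamilyR`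
(stmt-AtomisticToContinuum-11592). For a `C¹` parameter curve `τ ↦ (ρ̂, θ̂, û)(τ)` with `θ̂`
bounded below by a positive constant near `τ₀` and a continuous weight `q` of polynomial growth,
the moment `τ ↦ ∫ ρ̂(τ) M_{1,θ̂(τ),û(τ)}(v) q(v) dv` is differentiable at `τ₀` with derivative the
moment of the characteristic-derivative kernel (differentiation under the integral sign,
dominated by a Gaussian tail):

* `k2r_integrable_of_pow_four_mul_abs_le` — `(1+|v|)⁴ |g| ≤ C` gives integrability on `ℝ³`;
* `k2r_hasDerivAt_integral_maxwellian_param` — the derivative of the moments.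

References: C. Cercignani, R. Illner, M. Pulvirenti, *The Mathematical Theory of Dilute Gases*
(1994), §3.3 [CIP1994].
-/

noncomputable section

open MeasureTheory Set Filter Topology Metric
open scoped InnerProductSpace

namespace Summit.AtomisticToContinuum.HydrodynamicLimit.Theorems.EnskogAdjointDuality

open Literature.Analysis.FluidPDE Literature.MathematicalPhysics.KineticTheory

/-- `(1 + |v|)^{-4}` is integrable on `ℝ³`. [folklore] -/
theorem k2r_integrable_one_add_norm_rpow_neg_four :
    Integrable (fun v : V3 => (1 + ‖v‖) ^ (-(4 : ℝ))) := by
  refine integrable_one_add_norm ?_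
  simp only [finrank_euclideanSpace, Fintype.card_fin, Nat.cast_ofNat]
  norm_num

/-- A measurable function on `ℝ³` with `(1 + |v|)⁴ |g(v)| ≤ C` is integrable. [folklore] -/
theorem k2r_integrable_of_pow_four_mul_abs_le {g : V3 → ℝ} (hg : AEStronglyMeasurable g volume)
    {C : ℝ} (hC : ∀ v, (1 + ‖v‖) ^ 4 * |g v| ≤ C) : Integrable g := by
  refine (k2r_integrable_one_add_norm_rpow_neg_four.const_mul C).mono' hg
    (Eventually.of_forall fun v => ?_)
  have hpos : (0 : ℝ) < (1 + ‖v‖) ^ 4 := by positivity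
  rw [Real.norm_eq_abs, Real.rpow_neg (by positivity), show (4 : ℝ) = ((4 : ℕ) : ℝ) by norm_num,
    Real.rpow_natCast, ← div_eq_mul_inv, le_div_iff₀ hpos, mul_comm]
  exact hC v

/-- **Differentiating moments of the local Maxwellian along a parameter curve.** Let
`ρ̂, θ̂, û` be differentiable on a ball around `τ₀` with derivatives `ρd, θd, ud`, all of
`ρ̂, û, ρd, θd, ud` bounded there and `0 < θm ≤ θ̂ ≤ Θ`; let `q` be continuous with
`|q(v)| ≤ C_q (1+|v|)^k`. Then the kernel moment is integrable and
`d/dτ ∫ ρ̂ M_{1,θ̂,û} q dv = ∫ M_{1,θ̂,û} [ρd + ρ̂ (θd (|v−û|²/(2θ̂²) − 3/(2θ̂)) + ⟪ud, v−û⟫/θ̂)] q dv`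
at `τ₀`. [cite: CIP1994, §3.3] -/
theorem k2r_hasDerivAt_integral_maxwellian_param {ρh θh ρd θd : ℝ → ℝ} {uh ud : ℝ → V3}
    {τ₀ ε : ℝ} (hε : 0 < ε)
    (hρ : ∀ τ ∈ ball τ₀ ε, HasDerivAt ρh (ρd τ) τ)
    (hθ : ∀ τ ∈ ball τ₀ ε, HasDerivAt θh (θd τ) τ)
    (hu : ∀ τ ∈ ball τ₀ ε, HasDerivAt uh (ud τ) τ)
    {R U θm Θ B : ℝ} (hθm : 0 < θm)
    (hbd : ∀ τ ∈ ball τ₀ ε, |ρh τ| ≤ R ∧ ‖uh τ‖ ≤ U ∧ θm ≤ θh τ ∧ θh τ ≤ Θ ∧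
      |ρd τ| ≤ B ∧ |θd τ| ≤ B ∧ ‖ud τ‖ ≤ B)
    {q : V3 → ℝ} (hq : Continuous q) {Cq : ℝ} {k : ℕ} (hqb : ∀ v, |q v| ≤ Cq * (1 + ‖v‖) ^ k) :
    Integrable (fun v => localMaxwellian 1 (θh τ₀) (uh τ₀) v *
        (ρd τ₀ + ρh τ₀ * (θd τ₀ * (‖v - uh τ₀‖ ^ 2 / (2 * θh τ₀ ^ 2) - 3 / (2 * θh τ₀)) +
          ⟪ud τ₀, v - uh τ₀⟫_ℝ / θh τ₀)) * q v) ∧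
    HasDerivAt (fun τ => ∫ v, ρh τ * localMaxwellian 1 (θh τ) (uh τ) v * q v)
      (∫ v, localMaxwellian 1 (θh τ₀) (uh τ₀) v *
        (ρd τ₀ + ρh τ₀ * (θd τ₀ * (‖v - uh τ₀‖ ^ 2 / (2 * θh τ₀ ^ 2) - 3 / (2 * θh τ₀)) +
          ⟪ud τ₀, v - uh τ₀⟫_ℝ / θh τ₀)) * q v) τ₀ := by
  have hτ₀ : τ₀ ∈ ball τ₀ ε := mem_ball_self hε
  have hCq : 0 ≤ Cq := by
    have h := (abs_nonneg _).trans (hqb 0)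
    simpa using h
  -- constants
  obtain ⟨C₁, hC₁0, hC₁⟩ := k2r_exists_pow_mul_localMaxwellian_le (k + 4) U θm Θ hθm
  obtain ⟨C₂, hC₂0, hC₂⟩ := k2r_exists_pow_mul_charKernel_le (k + 4) R U θm Θ B hθm
  -- the family and its derivative
  set F : ℝ → V3 → ℝ := fun τ v => ρh τ * localMaxwellian 1 (θh τ) (uh τ) v * q v with hF
  set F' : ℝ → V3 → ℝ := fun τ v => localMaxwellian 1 (θh τ) (uh τ) v *
    (ρd τ + ρh τ * (θd τ * (‖v - uh τ‖ ^ 2 / (2 * θh τ ^ 2) - 3 / (2 * θh τ)) +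
      ⟪ud τ, v - uh τ⟫_ℝ / θh τ)) * q v with hF'
  have hFc : ∀ τ, Continuous (F τ) := fun τ => by
    simp only [hF]
    exact (continuous_const.mul (continuous_localMaxwellian 1 _ _)).mul hq
  have hF'c : ∀ τ, Continuous (F' τ) := fun τ => by
    simp only [hF']
    refine ((continuous_localMaxwellian 1 _ _).mul ?_).mul hq
    fun_prop
  -- pointwise bounds on the ball
  have hpow : ∀ v : V3, (1 + ‖v‖) ^ (k + 4) = (1 + ‖v‖) ^ 4 * (1 + ‖v‖) ^ k := fun v => by
    rw [pow_add, mul_comm]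
  have hFbd : ∀ v, (1 + ‖v‖) ^ 4 * |F τ₀ v| ≤ |R| * C₁ * Cq := by
    intro v
    obtain ⟨h1, h2, h3, h4, -, -, -⟩ := hbd τ₀ hτ₀
    have hM0 : 0 ≤ localMaxwellian 1 (θh τ₀) (uh τ₀) v :=
      localMaxwellian_nonneg zero_le_one (hθm.le.trans h3) _ v
    have hM := hC₁ _ _ v h3 h4 h2
    simp only [hF]
    rw [abs_mul, abs_mul, abs_of_nonneg hM0]
    calc (1 + ‖v‖) ^ 4 * (|ρh τ₀| * localMaxwellian 1 (θh τ₀) (uh τ₀) v * |q v|)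
        ≤ (1 + ‖v‖) ^ 4 * (|R| * localMaxwellian 1 (θh τ₀) (uh τ₀) v * (Cq * (1 + ‖v‖) ^ k)) := by
          refine mul_le_mul_of_nonneg_left ?_ (by positivity)
          exact mul_le_mul (mul_le_mul_of_nonneg_right (h1.trans (le_abs_self R)) hM0) (hqb v)
            (abs_nonneg _) (by positivity)
      _ = |R| * ((1 + ‖v‖) ^ (k + 4) * localMaxwellian 1 (θh τ₀) (uh τ₀) v) * Cq := by
          rw [hpow]; ring
      _ ≤ |R| * C₁ * Cq := by gcongr
  have hF'bd : ∀ τ ∈ ball τ₀ ε, ∀ v, (1 + ‖v‖) ^ 4 * |F' τ v| ≤ C₂ * Cq := by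
    intro τ hτ v
    obtain ⟨h1, h2, h3, h4, h5, h6, h7⟩ := hbd τ hτ
    have hB0 : 0 ≤ B := (abs_nonneg _).trans h5
    have hn : (1 : ℝ) ≤ 1 + ‖v‖ := le_add_of_nonneg_right (norm_nonneg _)
    have hB1 : B ≤ B * (1 + ‖v‖) := le_mul_of_one_le_right hB0 hn
    have hK := hC₂ (ρh τ) (θh τ) (ρd τ) (θd τ) (uh τ) (ud τ) v h1 h3 h4 h2 (h5.trans hB1)
      (h6.trans hB1) (h7.trans hB1)
    simp only [hF']
    rw [abs_mul]
    calc (1 + ‖v‖) ^ 4 * (|localMaxwellian 1 (θh τ) (uh τ) v * (ρd τ + ρh τ * (θd τ *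
          (‖v - uh τ‖ ^ 2 / (2 * θh τ ^ 2) - 3 / (2 * θh τ)) + ⟪ud τ, v - uh τ⟫_ℝ / θh τ))| * |q v|)
        ≤ (1 + ‖v‖) ^ 4 * (|localMaxwellian 1 (θh τ) (uh τ) v * (ρd τ + ρh τ * (θd τ *
          (‖v - uh τ‖ ^ 2 / (2 * θh τ ^ 2) - 3 / (2 * θh τ)) + ⟪ud τ, v - uh τ⟫_ℝ / θh τ))| *
            (Cq * (1 + ‖v‖) ^ k)) := by gcongr; exact hqb v
      _ = ((1 + ‖v‖) ^ (k + 4) * |localMaxwellian 1 (θh τ) (uh τ) v * (ρd τ + ρh τ * (θd τ *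
          (‖v - uh τ‖ ^ 2 / (2 * θh τ ^ 2) - 3 / (2 * θh τ)) + ⟪ud τ, v - uh τ⟫_ℝ / θh τ))|) *
            Cq := by rw [hpow]; ring
      _ ≤ C₂ * Cq := by gcongr
  -- differentiation under the integral sign
  have hmain := hasDerivAt_integral_of_dominated_loc_of_deriv_le (μ := (volume : Measure V3))
    (F := F) (F' := F') (x₀ := τ₀) (bound := fun v => (C₂ * Cq) * (1 + ‖v‖) ^ (-(4 : ℝ)))
    (ball_mem_nhds τ₀ hε) (Eventually.of_forall fun τ => (hFc τ).aestronglyMeasurable)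
    (k2r_integrable_of_pow_four_mul_abs_le (hFc τ₀).aestronglyMeasurable hFbd)
    (hF'c τ₀).aestronglyMeasurable ?_ (k2r_integrable_one_add_norm_rpow_neg_four.const_mul _) ?_
  · simpa only [hF, hF'] using hmain
  · refine Eventually.of_forall fun v τ hτ => ?_
    have hpos : (0 : ℝ) < (1 + ‖v‖) ^ 4 := by positivity
    rw [Real.norm_eq_abs, Real.rpow_neg (by positivity), show (4 : ℝ) = ((4 : ℕ) : ℝ) by norm_num,
      Real.rpow_natCast, ← div_eq_mul_inv, le_div_iff₀ hpos, mul_comm]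
    exact hF'bd τ hτ v
  · refine Eventually.of_forall fun v τ hτ => ?_
    obtain ⟨-, -, h3, -, -, -, -⟩ := hbd τ hτ
    have h := (k2r_hasDerivAt_localMaxwellian_param (hρ τ hτ) (hθ τ hτ) (hu τ hτ)
      (hθm.trans_le h3) v).mul_const (q v)
    simpa only [hF, hF'] using h

/-- **Registered form (sub-goal `stub_maxwellianCharDeriv_momentDeriv` of stub B2).**
Differentiating polynomial moments of the local Maxwellian along a `C¹` parameter curve under the
integral sign. [cite: CIP1994, §3.3] -/
theorem stub_maxwellianCharDeriv_momentDeriv :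
    ∀ (ρh θh ρd θd : ℝ → ℝ) (uh ud : ℝ → EuclideanSpace ℝ (Fin 3)) (τ₀ ε : ℝ), 0 < ε →
    (∀ τ ∈ Metric.ball τ₀ ε, HasDerivAt ρh (ρd τ) τ) →
    (∀ τ ∈ Metric.ball τ₀ ε, HasDerivAt θh (θd τ) τ) →
    (∀ τ ∈ Metric.ball τ₀ ε, HasDerivAt uh (ud τ) τ) →
    ∀ (R U θm Θ B : ℝ), 0 < θm →
    (∀ τ ∈ Metric.ball τ₀ ε, |ρh τ| ≤ R ∧ ‖uh τ‖ ≤ U ∧ θm ≤ θh τ ∧ θh τ ≤ Θ ∧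
      |ρd τ| ≤ B ∧ |θd τ| ≤ B ∧ ‖ud τ‖ ≤ B) →
    ∀ (q : EuclideanSpace ℝ (Fin 3) → ℝ), Continuous q → ∀ (Cq : ℝ) (k : ℕ),
    (∀ v, |q v| ≤ Cq * (1 + ‖v‖) ^ k) →
    HasDerivAt (fun τ => ∫ v : EuclideanSpace ℝ (Fin 3),
        ρh τ * Literature.Analysis.FluidPDE.localMaxwellian 1 (θh τ) (uh τ) v * q v)
      (∫ v : EuclideanSpace ℝ (Fin 3), Literature.Analysis.FluidPDE.localMaxwellian 1 (θh τ₀) (uh τ₀) v *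
        (ρd τ₀ + ρh τ₀ * (θd τ₀ * (‖v - uh τ₀‖ ^ 2 / (2 * θh τ₀ ^ 2) - 3 / (2 * θh τ₀)) +
          inner ℝ (ud τ₀) (v - uh τ₀) / θh τ₀)) * q v) τ₀ :=
  fun _ _ _ _ _ _ _ _ hε hρ hθ hu _ _ _ _ _ hθm hbd _ hq _ _ hqb =>
    (k2r_hasDerivAt_integral_maxwellian_param hε hρ hθ hu hθm hbd hq hqb).2

end Summit.AtomisticToContinuum.HydrodynamicLimit.Theorems.EnskogAdjointDuality

end
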